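import Mathlib.Analysis.Calculus.MeanValue
import Mathlib.Analysis.Calculus.Deriv.MeanValue
import Mathlib.Topology.UniformSpace.HeineCantor
import Literature.Geometry.Riemannian.GreatSphereFibrationTransition
import HarnessLib

/-!
# Radial monotonicity of the transition map of the base near `∞` (Hähl 1987, 4.5–4.7)

Sixth file of the proof programme for the corrected form of
`Literature.Geometry.Riemannian.Hahl1987_greatSphereFibration_base_sphere` (H. Hähl, Results
Math. 12 (1987) 99–118, Prop. 4.7). Notation of `GreatSphereFibrationTransition.lean`: charts
`Φ = baseChart p x∞ e J∞` (centre `0 = p e`, misses `∞ = p x∞`) and `Ψ = baseChart p x∞ x∞ J₀`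
(centre `∞`, misses `0`); `transG (b, u) = Φ⁻¹ (𝒫 (J₀ b + u x∞))`, which for `u > 0` is the
transition map `Φ⁻¹ (Ψ (b / u))` along the ray of `b`, with `u`-derivative `transD`.

Hähl proves (4.5–4.7) that the gluing map `ψ̃ = Φ⁻¹ ∘ Ψ` of `B(π) = ℝⁿ ∪_ψ̃ ℝⁿ` is isotopic to a
conical diffeomorphism, and concludes by the isotopy extension theorem. The tree proof replaces
the isotopy by the following quantitative statement, which is what the isotopy delivers near `∞`:
**along every ray of the chart `Ψ`, the `Φ`-norm `‖Φ⁻¹ (Ψ (r b))‖` is strictly decreasing for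
large `r`, uniformly in the direction `b`** — in the parameter `u = 1/r`: `u ↦ ‖transG (b, u)‖`
is strictly increasing on a uniform window `[0, u₀]` (`exists_radialWindow`). Proof: `transG (b, 0)
= 0` and `v_b = ∂ᵤ transG (b, 0) ≠ 0` (`transD_ne_zero`), `|v_b| ≥ μ > 0` on the unit sphere
(compactness, `exists_pos_le_norm_transD`); `∂ᵤ transG` is uniformly continuous on
`S × [-1, 1]` (Heine–Cantor), so `‖∂ᵤ transG (b, u) - v_b‖ ≤ μ/4` for `|u| ≤ u₀`
(`exists_transD_window`); the mean value inequality then gives `‖transG (b, u) - u v_b‖ ≤ μ u/4`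
and hence `⟪transG, ∂ᵤ transG⟫ ≥ (7/16) μ² u > 0` (`inner_transG_transD_ge`), i.e.
`∂ᵤ ‖transG‖² > 0` on `(0, u₀]`.

A second uniformity statement transfers smallness from values to parameters: if
`‖transG (b, u)‖` is small then `u` is small, uniformly in `b ∈ S` (`exists_norm_transG_le_imp_lt`)
— because `u • c∞ = spreadCoord J∞ (J₀ b) (Φ (transG (b, u)))` depends LINEARLY on `b`
(`spreadCoord_add`) through coefficients that are continuous in `transG (b, u)` and vanish at `0`
(Hähl 2.2: `A_a → A_0 = 0`).

Both are packaged as `GoodLevel … t` (a level `t > 0` small enough for the two-disc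
decomposition of the base at `Φ`-radius `t`), with `exists_goodLevel`.

Everything is proved; one `structure` (`GoodLevel`, a conjunction of properties). No named facts.

## References

* [Hahl1987] H. Hähl, Results Math. 12 (1987) 99–118 — 2.2, 4.3, 4.5, 4.7.
-/

noncomputable section

open Set Function Module Submodule Metric Filter
open scoped Manifold ContDiff Topology RealInnerProductSpace

namespace Literature.Geometry.Riemannian

variable {E : Type*} [NormedAddCommGroup E] [InnerProductSpace ℝ E] {M : Type*} {k : ℕ}
  {p : sphere (0 : E) 1 → M} {xinf e : sphere (0 : E) 1}
  (Jinf : EuclideanSpace ℝ (Fin k) ≃L[ℝ] fibreSpan p xinf)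
  (J₀ : EuclideanSpace ℝ (Fin k) ≃L[ℝ] fibreSpan p e)

/-- Local notation for the coordinate space `ℝᵏ`. -/
local notation "𝔼k" => EuclideanSpace ℝ (Fin k)

/-- **A good level** `t` for the two-disc decomposition of the base: `t > 0` and there is a window
`u₀ > 0` such that, for every unit direction `b`, `u ↦ ‖transG (b, u)‖` is strictly increasing on
`[0, u₀]` with positive derivative of its square on `(0, u₀]`, exceeds `t` at `u₀`, and takes
values `≤ t` only for parameters `u < u₀` (`u ≥ 0`). [cite: Hahl1987, 4.7] -/
structure GoodLevel (Jinf : EuclideanSpace ℝ (Fin k) ≃L[ℝ] fibreSpan p xinf)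
    (J₀ : EuclideanSpace ℝ (Fin k) ≃L[ℝ] fibreSpan p e) (t : ℝ) : Prop where
  /-- the level is positive -/
  pos : 0 < t
  /-- the uniform window -/
  exists_window : ∃ u₀ : ℝ, 0 < u₀ ∧
    (∀ b ∈ sphere (0 : EuclideanSpace ℝ (Fin k)) 1,
      StrictMonoOn (fun u : ℝ => ‖transG Jinf J₀ (b, u)‖) (Icc 0 u₀)) ∧
    (∀ b ∈ sphere (0 : EuclideanSpace ℝ (Fin k)) 1, ∀ u ∈ Ioc 0 u₀,
      0 < deriv (fun s : ℝ => ‖transG Jinf J₀ (b, s)‖ ^ 2) u) ∧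
    (∀ b ∈ sphere (0 : EuclideanSpace ℝ (Fin k)) 1, t < ‖transG Jinf J₀ (b, u₀)‖) ∧
    (∀ b ∈ sphere (0 : EuclideanSpace ℝ (Fin k)) 1, ∀ u : ℝ, 0 ≤ u →
      ‖transG Jinf J₀ (b, u)‖ ≤ t → u < u₀)

section WithHyp

variable {d : ℕ} [Fact (finrank ℝ E = d + 1)] [TopologicalSpace M]
  [ChartedSpace (EuclideanSpace ℝ (Fin k)) M] [IsManifold (𝓡 k) ∞ M]
  (hp : IsGreatSphereSubmersion d k p) (he : p e ≠ p xinf)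
include hp he

/-! ### A uniform lower bound for `∂ᵤ transG (b, 0)` on the unit sphere -/

/-- **`|∂ᵤ transG (b, 0)| ≥ μ > 0` uniformly on the unit sphere** (a positive continuous function
on a compact set). [cite: Hahl1987, 4.5] -/
theorem exists_pos_le_norm_transD :
    ∃ μ : ℝ, 0 < μ ∧ ∀ b ∈ sphere (0 : 𝔼k) 1, μ ≤ ‖transD Jinf J₀ (b, 0)‖ := by
  rcases (sphere (0 : 𝔼k) 1).eq_empty_or_nonempty with h | h
  · exact ⟨1, one_pos, fun b hb => by rw [h] at hb; exact absurd hb (notMem_empty b)⟩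
  · have hcont : ContinuousOn (fun b : 𝔼k => ‖transD Jinf J₀ (b, 0)‖) (sphere 0 1) := by
      intro b hb
      have hb0 : b ≠ 0 := ne_zero_of_mem_unit_sphere ⟨b, hb⟩
      have h2 : ContinuousAt (fun b' : 𝔼k => ((b', (0 : ℝ)) : 𝔼k × ℝ)) b :=
        (continuous_id.prodMk continuous_const).continuousAt
      exact (((continuousAt_transD Jinf J₀ hp he hb0 0).comp_of_eq h2 rfl).norm).continuousWithinAt
    obtain ⟨b₀, hb₀, hmin⟩ := (isCompact_sphere 0 1).exists_isMinOn h hcont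
    exact ⟨‖transD Jinf J₀ (b₀, 0)‖, norm_pos_iff.2
      (transD_ne_zero Jinf J₀ hp he (ne_zero_of_mem_unit_sphere ⟨b₀, hb₀⟩)), fun b hb => hmin hb⟩

/-- **A uniform window** on which `∂ᵤ transG (b, u)` stays `μ/4`-close to its value at `u = 0`
(Heine–Cantor on the compact set `S × [-1, 1]`). [cite: Hahl1987, 4.5] -/
theorem exists_transD_window {μ : ℝ} (hμ : 0 < μ) :
    ∃ u₀ : ℝ, 0 < u₀ ∧ u₀ ≤ 1 ∧ ∀ b ∈ sphere (0 : 𝔼k) 1, ∀ u : ℝ, |u| ≤ u₀ →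
      ‖transD Jinf J₀ (b, u) - transD Jinf J₀ (b, 0)‖ ≤ μ / 4 := by
  set K : Set (𝔼k × ℝ) := sphere 0 1 ×ˢ Icc (-1) 1 with hK
  have hKc : IsCompact K := (isCompact_sphere 0 1).prod isCompact_Icc
  have hcont : ContinuousOn (transD Jinf J₀) K :=
    (continuousOn_transD Jinf J₀ hp he).mono fun q hq => ne_zero_of_mem_unit_sphere ⟨q.1, hq.1⟩
  obtain ⟨δ, hδ, hδ'⟩ := Metric.uniformContinuousOn_iff.1 (hKc.uniformContinuousOn_of_continuous hcont)
    (μ / 4) (by positivity)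
  refine ⟨min (δ / 2) 1, by positivity, min_le_right _ _, fun b hb u hu => ?_⟩
  have hu1 : |u| ≤ 1 := hu.trans (min_le_right _ _)
  have hmem : (b, u) ∈ K := ⟨hb, abs_le.1 hu1⟩
  have hmem0 : (b, (0 : ℝ)) ∈ K := ⟨hb, by constructor <;> norm_num⟩
  have hdist : dist (b, u) (b, (0 : ℝ)) < δ := by
    rw [Prod.dist_eq, dist_self, Real.dist_eq, sub_zero, max_eq_right (abs_nonneg u)]
    exact lt_of_le_of_lt hu (lt_of_le_of_lt (min_le_left _ _) (by linarith))
  have := hδ' _ hmem _ hmem0 hdist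
  rw [dist_eq_norm] at this
  exact this.le

/-! ### The key estimate and radial monotonicity -/

/-- **The key estimate** `⟪transG (b, u), ∂ᵤ transG (b, u)⟫ ≥ (7/16) μ² u` for `0 < u ≤ u₀`, `b` a
unit vector (mean value inequality on `[0, u]` for `transG (b, ·) - (·) • v_b`).
[cite: Hahl1987, 4.5] -/
theorem inner_transG_transD_ge {μ u₀ : ℝ} (hμ : 0 < μ)
    (hμle : ∀ b ∈ sphere (0 : 𝔼k) 1, μ ≤ ‖transD Jinf J₀ (b, 0)‖)
    (hwin : ∀ b ∈ sphere (0 : 𝔼k) 1, ∀ u : ℝ, |u| ≤ u₀ →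
      ‖transD Jinf J₀ (b, u) - transD Jinf J₀ (b, 0)‖ ≤ μ / 4)
    {b : 𝔼k} (hb : b ∈ sphere (0 : 𝔼k) 1) {u : ℝ} (hu : 0 < u) (huu : u ≤ u₀) :
    7 / 16 * μ ^ 2 * u ≤ ⟪transG Jinf J₀ (b, u), transD Jinf J₀ (b, u)⟫ := by
  have hb0 : b ≠ 0 := ne_zero_of_mem_unit_sphere ⟨b, hb⟩
  set v := transD Jinf J₀ (b, 0) with hv
  -- mean value inequality for `f s = transG (b, s) - s • v` on `[0, u]`
  have hmvt : ‖transG Jinf J₀ (b, u) - u • v‖ ≤ μ / 4 * u := by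
    have hf : ∀ s ∈ Icc 0 u, HasDerivWithinAt (fun s : ℝ => transG Jinf J₀ (b, s) - s • v)
        (transD Jinf J₀ (b, s) - v) (Icc 0 u) s := fun s _ =>
      ((hasDerivAt_transG Jinf J₀ hp he hb0 s).sub ((hasDerivAt_id s).smul_const v |>.congr_deriv
        (by simp))).hasDerivWithinAt
    have hbound : ∀ s ∈ Ico 0 u, ‖transD Jinf J₀ (b, s) - v‖ ≤ μ / 4 := fun s hs =>
      hwin b hb s (by rw [abs_of_nonneg hs.1]; linarith [hs.2])
    have := norm_image_sub_le_of_norm_deriv_le_segment' hf hbound u ⟨hu.le, le_rfl⟩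
    rwa [transG_zero Jinf J₀ hp he hb0, zero_smul, sub_zero, sub_zero, sub_zero] at this
  set r := transG Jinf J₀ (b, u) - u • v with hr
  set s := transD Jinf J₀ (b, u) - v with hs
  have hrn : ‖r‖ ≤ μ / 4 * u := hmvt
  have hsn : ‖s‖ ≤ μ / 4 := by
    have := hwin b hb u (by rw [abs_of_pos hu]; exact huu)
    exact this
  have hvn : μ ≤ ‖v‖ := hμle b hb
  have hG : transG Jinf J₀ (b, u) = u • v + r := by rw [hr]; abel
  have hD : transD Jinf J₀ (b, u) = v + s := by rw [hs]; abel
  rw [hG, hD, inner_add_left, inner_add_right, inner_add_right, real_inner_smul_left,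
    real_inner_smul_left, real_inner_self_eq_norm_sq]
  -- Cauchy–Schwarz bounds
  have h1 : -(‖v‖ * ‖s‖) ≤ ⟪v, s⟫ := neg_le_of_abs_le (abs_real_inner_le_norm v s)
  have h2 : -(‖r‖ * ‖v‖) ≤ ⟪r, v⟫ := neg_le_of_abs_le (abs_real_inner_le_norm r v)
  have h3 : -(‖r‖ * ‖s‖) ≤ ⟪r, s⟫ := neg_le_of_abs_le (abs_real_inner_le_norm r s)
  have h1' : -(‖v‖ * (μ / 4)) ≤ ⟪v, s⟫ :=
    le_trans (by nlinarith [norm_nonneg v]) h1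
  have h2' : -(μ / 4 * u * ‖v‖) ≤ ⟪r, v⟫ :=
    le_trans (by nlinarith [norm_nonneg v]) h2
  have h3' : -(μ / 4 * u * (μ / 4)) ≤ ⟪r, s⟫ :=
    le_trans (by nlinarith [norm_nonneg r, norm_nonneg s]) h3
  have key : μ ^ 2 / 2 ≤ ‖v‖ ^ 2 - ‖v‖ * μ / 2 := by nlinarith
  nlinarith [mul_le_mul_of_nonneg_left h1' hu.le, mul_le_mul_of_nonneg_left key hu.le]

/-- `u ↦ transG (b, u)` is continuous (`b ≠ 0`). [folklore] -/
theorem continuous_transG_right {b : 𝔼k} (hb : b ≠ 0) :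
    Continuous fun u : ℝ => transG Jinf J₀ (b, u) :=
  continuous_iff_continuousAt.2 fun u => (hasDerivAt_transG Jinf J₀ hp he hb u).continuousAt

/-- The derivative of `u ↦ ‖transG (b, u)‖²` is `2 ⟪transG, ∂ᵤ transG⟫`. [folklore] -/
theorem hasDerivAt_norm_sq_transG {b : 𝔼k} (hb : b ≠ 0) (u : ℝ) :
    HasDerivAt (fun s : ℝ => ‖transG Jinf J₀ (b, s)‖ ^ 2)
      (2 * ⟪transG Jinf J₀ (b, u), transD Jinf J₀ (b, u)⟫) u :=
  (hasDerivAt_transG Jinf J₀ hp he hb u).norm_sq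

/-- **Radial monotonicity** (the quantitative substitute for Hähl's isotopy 4.5): there is a
uniform window `u₀ > 0` such that for every unit direction `b`, `u ↦ ‖transG (b, u)‖` is strictly
increasing on `[0, u₀]`, with `∂ᵤ ‖transG‖² > 0` on `(0, u₀]`. In the chart `Ψ` this says: along
each ray `r ↦ Ψ (r b)`, the `Φ`-norm is strictly decreasing for `r ≥ 1/u₀`. [cite: Hahl1987, 4.5 and 4.7] -/
theorem exists_radialWindow :
    ∃ u₀ : ℝ, 0 < u₀ ∧
      (∀ b ∈ sphere (0 : 𝔼k) 1, StrictMonoOn (fun u : ℝ => ‖transG Jinf J₀ (b, u)‖) (Icc 0 u₀)) ∧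
      (∀ b ∈ sphere (0 : 𝔼k) 1, ∀ u ∈ Ioc 0 u₀,
        0 < deriv (fun s : ℝ => ‖transG Jinf J₀ (b, s)‖ ^ 2) u) := by
  obtain ⟨μ, hμ, hμle⟩ := exists_pos_le_norm_transD Jinf J₀ hp he
  obtain ⟨u₀, hu₀, -, hwin⟩ := exists_transD_window Jinf J₀ hp he hμ
  have hderiv : ∀ b ∈ sphere (0 : 𝔼k) 1, ∀ u ∈ Ioc 0 u₀,
      0 < deriv (fun s : ℝ => ‖transG Jinf J₀ (b, s)‖ ^ 2) u := by
    intro b hb u hu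
    have hb0 : b ≠ 0 := ne_zero_of_mem_unit_sphere ⟨b, hb⟩
    rw [(hasDerivAt_norm_sq_transG Jinf J₀ hp he hb0 u).deriv]
    have := inner_transG_transD_ge Jinf J₀ hp he hμ hμle hwin hb hu.1 hu.2
    have hpos : 0 < μ ^ 2 * u := by have := hu.1; positivity
    nlinarith
  refine ⟨u₀, hu₀, fun b hb => ?_, hderiv⟩
  have hb0 : b ≠ 0 := ne_zero_of_mem_unit_sphere ⟨b, hb⟩
  -- strict monotonicity of the square, then of the norm
  have hsq : StrictMonoOn (fun u : ℝ => ‖transG Jinf J₀ (b, u)‖ ^ 2) (Icc 0 u₀) := by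
    refine strictMonoOn_of_deriv_pos (convex_Icc 0 u₀)
      (((continuous_transG_right Jinf J₀ hp he hb0).norm.pow 2).continuousOn) fun u hu => ?_
    rw [interior_Icc] at hu
    exact hderiv b hb u ⟨hu.1, hu.2.le⟩
  intro u hu u' hu' h
  have := hsq hu hu' h
  exact lt_of_pow_lt_pow_left₀ 2 (norm_nonneg _) this

/-! ### Smallness transfer: small `Φ`-norm forces a small parameter -/

omit [IsManifold (𝓡 k) ∞ M] in
/-- The identity behind the transfer: `spreadCoord J∞ (J₀ b) (Φ (transG (b, u))) = u • c∞` for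
`b ≠ 0` — read in the chart with base vector `J₀ b`, the point `𝒫 (J₀ b + u x∞)` has coordinate
`u • c∞`. [cite: Hahl1987, 2.2] -/
theorem spreadCoord_frame_baseChart_transG {b : 𝔼k} (hb : b ≠ 0) (u : ℝ) :
    spreadCoord Jinf ((J₀ b : fibreSpan p e) : E) (baseChart p xinf (e : E) Jinf (transG Jinf J₀ (b, u))) =
      u • cinf Jinf := by
  rw [transG]
  exact spreadCoord_baseChart_transΘ Jinf J₀ hp he hb _

/-- **Smallness transfer**: for every `ε > 0` there is `τ > 0` such that for all unit `b` and
`u ≥ 0`, `‖transG (b, u)‖ ≤ τ` forces `u < ε`. Proof: `u • c∞ = Σᵢ bᵢ • spreadCoord J∞ (J₀ eᵢ) (Φ q)`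
with `q = transG (b, u)` (linearity of `spreadCoord` in the base vector), and the coefficient maps
`q ↦ spreadCoord J∞ (J₀ eᵢ) (Φ q)` are continuous with value `0` at `q = 0` (the centre of `Φ` is the
fibre `U₀ ∋ J₀ eᵢ`). [cite: Hahl1987, 2.2 and 4.7] -/
theorem exists_norm_transG_le_imp_lt {ε : ℝ} (hε : 0 < ε) :
    ∃ τ : ℝ, 0 < τ ∧ ∀ b ∈ sphere (0 : 𝔼k) 1, ∀ u : ℝ, 0 ≤ u →
      ‖transG Jinf J₀ (b, u)‖ ≤ τ → u < ε := by
  classical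
  have he' : (e : E) ∉ fibreSpan p xinf := coe_notMem_fibreSpan_inf hp he
  set eb : Fin k → 𝔼k := fun i => EuclideanSpace.basisFun (Fin k) ℝ i with heb
  have heb0 : ∀ i, eb i ≠ 0 := fun i h => by
    have h1 : ‖eb i‖ = 1 := (EuclideanSpace.basisFun (Fin k) ℝ).orthonormal.1 i
    rw [h, norm_zero] at h1
    exact zero_ne_one h1
  set L : Fin k → 𝔼k → 𝔼k := fun i q =>
    spreadCoord Jinf ((J₀ (eb i) : fibreSpan p e) : E) (baseChart p xinf (e : E) Jinf q) with hL
  set Λ : 𝔼k → ℝ := fun q => ∑ i, ‖L i q‖ with hΛ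
  -- continuity of `Λ`
  have hLc : ∀ i, Continuous (L i) := fun i => by
    refine continuous_iff_continuousAt.2 fun q => ?_
    have h1 : ContinuousAt (baseChart p xinf (e : E) Jinf) q :=
      (contMDiff_baseChart Jinf hp.contMDiff he' (x₀ := xinf)).continuous.continuousAt
    exact (continuousAt_spreadCoord Jinf hp (frame_notMem J₀ hp he (heb0 i))
      (baseChart_ne Jinf hp he' q)).comp h1
  have hΛc : Continuous Λ := continuous_finsetSum _ fun i _ => (hLc i).norm
  -- `Λ 0 = 0`
  have hΦ0 : baseChart p xinf (e : E) Jinf 0 = p e := by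
    rw [baseChart_apply, map_zero, ZeroMemClass.coe_zero, add_zero, coneExtension_coe]
  have hΛ0 : Λ 0 = 0 := by
    refine Finset.sum_eq_zero fun i _ => ?_
    rw [norm_eq_zero, hL]
    simp only
    rw [hΦ0, spreadCoord_eq_zero_iff Jinf hp he, baseSpan_apply]
    exact (J₀ (eb i)).2
  -- choose `τ`
  have hcpos : 0 < ε * ‖cinf Jinf‖ := mul_pos hε (norm_pos_iff.2 (cinf_ne_zero Jinf))
  obtain ⟨τ', hτ', hτ'Λ⟩ := Metric.continuousAt_iff.1 hΛc.continuousAt (ε * ‖cinf Jinf‖) hcpos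
  refine ⟨τ' / 2, by positivity, fun b hb u hu hq => ?_⟩
  have hb0 : b ≠ 0 := ne_zero_of_mem_unit_sphere ⟨b, hb⟩
  set q := transG Jinf J₀ (b, u) with hq_def
  have hΛq : Λ q < ε * ‖cinf Jinf‖ := by
    have := hτ'Λ (x := q) (by rw [dist_zero_right]; linarith)
    rw [hΛ0, Real.dist_eq, sub_zero] at this
    exact lt_of_abs_lt this
  -- expand `b` in the basis and use linearity of `spreadCoord` in the base vector
  have hbsum : b = ∑ i, b i • eb i := ((EuclideanSpace.basisFun (Fin k) ℝ).sum_repr b).symm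
  have hkey := spreadCoord_frame_baseChart_transG Jinf J₀ hp he hb0 u
  have hexp : spreadCoord Jinf ((J₀ b : fibreSpan p e) : E) (baseChart p xinf (e : E) Jinf q) =
      ∑ i, b i • L i q := by
    conv_lhs => rw [hbsum]
    rw [map_sum, Submodule.coe_sum, spreadCoord_sum]
    refine Finset.sum_congr rfl fun i _ => ?_
    rw [map_smul, Submodule.coe_smul, spreadCoord_smul]
  rw [hexp] at hkey
  -- norms
  have hnorm : u * ‖cinf Jinf‖ ≤ Λ q := by
    have h1 : u * ‖cinf Jinf‖ = ‖∑ i, b i • L i q‖ := by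
      rw [hkey, norm_smul, Real.norm_of_nonneg hu]
    rw [h1]
    refine (norm_sum_le _ _).trans (Finset.sum_le_sum fun i _ => ?_)
    rw [norm_smul]
    have hbi : ‖b i‖ ≤ 1 := by
      have := PiLp.norm_apply_le b i
      rwa [norm_eq_of_mem_sphere ⟨b, hb⟩] at this
    calc ‖b i‖ * ‖L i q‖ ≤ 1 * ‖L i q‖ := by gcongr
      _ = ‖L i q‖ := one_mul _
  have : u * ‖cinf Jinf‖ < ε * ‖cinf Jinf‖ := lt_of_le_of_lt hnorm hΛq
  exact lt_of_mul_lt_mul_right this (norm_nonneg _)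

/-! ### Good levels exist -/

/-- **Good levels exist**: every sufficiently small `t > 0` is a good level. Take the radial window
`u₀`, the transfer constant `τ` for `ε = u₀`, and `t < min τ (min_b ‖transG (b, u₀)‖)`.
[cite: Hahl1987, 4.7] -/
theorem exists_goodLevel : ∃ t : ℝ, GoodLevel Jinf J₀ t := by
  obtain ⟨u₀, hu₀, hmono, hderiv⟩ := exists_radialWindow Jinf J₀ hp he
  obtain ⟨τ, hτ, hτu⟩ := exists_norm_transG_le_imp_lt Jinf J₀ hp he hu₀
  -- a positive lower bound for `‖transG (b, u₀)‖` on the unit sphere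
  obtain ⟨m₀, hm₀, hm₀le⟩ : ∃ m₀ : ℝ, 0 < m₀ ∧ ∀ b ∈ sphere (0 : 𝔼k) 1,
      m₀ ≤ ‖transG Jinf J₀ (b, u₀)‖ := by
    rcases (sphere (0 : 𝔼k) 1).eq_empty_or_nonempty with h | h
    · exact ⟨1, one_pos, fun b hb => by rw [h] at hb; exact absurd hb (notMem_empty b)⟩
    · have hcont : ContinuousOn (fun b : 𝔼k => ‖transG Jinf J₀ (b, u₀)‖) (sphere 0 1) := by
        intro b hb
        have hb0 : b ≠ 0 := ne_zero_of_mem_unit_sphere ⟨b, hb⟩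
        have h2 : ContinuousAt (fun b' : 𝔼k => ((b', u₀) : 𝔼k × ℝ)) b :=
          (continuous_id.prodMk continuous_const).continuousAt
        exact (((contDiffAt_transG Jinf J₀ hp he hb0 u₀).continuousAt.comp_of_eq h2
          rfl).norm).continuousWithinAt
      obtain ⟨b₀, hb₀, hmin⟩ := (isCompact_sphere 0 1).exists_isMinOn h hcont
      have hpos : 0 < ‖transG Jinf J₀ (b₀, u₀)‖ := by
        have h0 : ‖transG Jinf J₀ (b₀, 0)‖ = 0 := by
          rw [transG_zero Jinf J₀ hp he (ne_zero_of_mem_unit_sphere ⟨b₀, hb₀⟩), norm_zero]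
        have := hmono b₀ hb₀ ⟨le_rfl, hu₀.le⟩ ⟨hu₀.le, le_rfl⟩ hu₀
        simpa [h0] using this
      exact ⟨_, hpos, fun b hb => hmin hb⟩
  refine ⟨min τ m₀ / 2, ⟨by positivity, u₀, hu₀, hmono, hderiv, fun b hb => ?_, fun b hb u hu h => ?_⟩⟩
  · have := hm₀le b hb
    have h2 : min τ m₀ / 2 < m₀ := by
      have := min_le_right τ m₀; linarith
    linarith
  · have h2 : min τ m₀ / 2 ≤ τ := by
      have := min_le_left τ m₀; linarith
    exact hτu b hb u hu (h.trans h2)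

end WithHyp

end Literature.Geometry.Riemannian

end
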